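import Mathlib
import HarnessLib
import Literature.Probability.Process.RootedHardCoreConfig
import Literature.Probability.Process.PointStationaryLaw
import Summits.AtomisticToContinuum.Crystallization.Theorems.ChartedPlanarOrderRigidityDoor
import Summits.AtomisticToContinuum.Crystallization.Theorems.ChartedPlanarOrderDefectEventGeometry
import Summits.AtomisticToContinuum.Crystallization.Theorems.ChartedPlanarOrderMatchedRootBorelParam
import Summits.AtomisticToContinuum.Crystallization.Theorems.ChartedPlanarOrderMatchedRootTransport

/-!
# The matched-root event is Borel on configuration space; hence `SparseNull ν` for every `ν`

decomp-a2c · N `stmt-AtomisticToContinuum-26636` · lens-3 g21 plan «MatchedRootBorel» (critic row 368 (1)), proved by hand-1 g8.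
Target: the hypothesis of `ChartedPlanarOrderMatchedRootTransport.sparseNull_of_measurableSet_config` (lens-3, p814353),

    `∀ δ > 0, MeasurableSet {S : RootedHardCoreConfig E3 δ | matchedAt ν (count|S) 0}`,

and with it lens-3's TRUE piece `SparseNull ν` of the `RigidityDoor` node (via hand-1 g7's Mecke half p812751), for EVERY `ν`.

The `≤ ν` matched-root event is neither closed (atoms of norm exactly `4b`, template points of norm exactly `5b`) nor a
countable union over a parameter net (saturated matchings).  Cure (lens-3): put the slack into the RADII.  With
`MarginEvent ν r₁' r₁ r₂' r₂ I S` := «some admissible template `π ∈ piSet` with `4b ≤ r₁' < r₁`, `5b ≤ r₂' < r₂` matches every atom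
of the OPEN ball `‖y‖ < r₁` within `ν`, has an atom within `ν` of each template point with index in the finite set `I`, and has all
other template points at norm `≥ r₂`» (`r`'s rational):

* `matchedAt_iff_exists_marginEvent` (STUB 1): on a rooted hard-core configuration, `matchedAt ν (count|S) 0 ↔ ∃ r₁' r₁ r₂' r₂ I,
  MarginEvent …` — local finiteness of the atoms (`finite_inter_of_separated`) and of the template (uniform index box
  `exists_index_finset`) leaves norm gaps above `4b` and `5b` into which the rational radii fit;
* `isClosed_marginEvent` (STUB 2): each margin event is CLOSED in the local rubber topology of `RootedHardCoreConfig E3 δ` — the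
  constrained parameters form a compact set (`isCompact_piSet` ∩ closed conditions, `continuous_pt`), so along a convergent sequence
  of configurations a subsequence of witnessing parameters converges; the atom clause passes to the limit because its radius is OPEN
  (approximating atoms are eventually constrained) and the matching indices stay in a uniform finite box; the template clause because
  `I` is fixed and the limit configuration has finitely many atoms in a ball (`tendsto_iff_locallyMatches`);
* `measurableSet_matchedAt_config` (composition, countable union of closed sets) and **`sparseNull_holds : ∀ ν, SparseNull ν`**.

Filed `--supports stmt-AtomisticToContinuum-26636` (helper).  One new definition (`MarginEvent`, the event of the decomposition); axioms standard.
-/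

noncomputable section

namespace Summit.AtomisticToContinuum.Crystallization.Theorems.ChartedPlanarOrderMatchedRootBorel

open MeasureTheory Metric Set Filter Topology
open Literature.MathematicalPhysics.StatisticalMechanics
open Literature.Probability.Process
open Summit.AtomisticToContinuum.Crystallization.Theorems.ChartedPlanarOrderRigidityDoor
open Summit.AtomisticToContinuum.Crystallization.Theorems.ChartedPlanarOrderDefectEventGeometry

/-! ## Two finite-minimum lemmas -/

/-- **norm gap above a level**: if only finitely many members of `s` have `f ≤ r + 1`, then for some `ε > 0` every member with
`f < r + ε` already has `f ≤ r`. [folklore] -/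
theorem exists_gap_on {ι : Type*} (s : Set ι) (f : ι → ℝ) (r : ℝ) (hfin : {i | i ∈ s ∧ f i ≤ r + 1}.Finite) :
    ∃ ε : ℝ, 0 < ε ∧ ∀ i ∈ s, f i < r + ε → f i ≤ r := by
  classical
  set T := hfin.toFinset.filter (fun i => r < f i) with hT
  rcases T.eq_empty_or_nonempty with hTe | hTn
  · refine ⟨1, one_pos, fun i hi hlt => ?_⟩
    by_contra h
    have : i ∈ T := by
      rw [hT, Finset.mem_filter, Set.Finite.mem_toFinset]
      exact ⟨⟨hi, hlt.le⟩, lt_of_not_ge h⟩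
    rw [hTe] at this
    simp at this
  · obtain ⟨i₀, hi₀T, hmin⟩ := T.exists_min_image f hTn
    have hi₀ : r < f i₀ := (Finset.mem_filter.mp hi₀T).2
    refine ⟨min 1 (f i₀ - r), lt_min one_pos (by linarith), fun i hi hlt => ?_⟩
    by_contra h
    have hiT : i ∈ T := by
      rw [hT, Finset.mem_filter, Set.Finite.mem_toFinset]
      exact ⟨⟨hi, (hlt.trans_le (by linarith [min_le_left (1 : ℝ) (f i₀ - r)])).le⟩, lt_of_not_ge h⟩
    have := hmin i hiT
    linarith [min_le_right (1 : ℝ) (f i₀ - r)]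

/-- a function positive on a finite set is bounded below there by a positive constant `≤ 1`. [folklore] -/
theorem exists_pos_le_of_finite {ι : Type*} {s : Set ι} (hs : s.Finite) (f : ι → ℝ) (h : ∀ i ∈ s, 0 < f i) :
    ∃ γ : ℝ, 0 < γ ∧ γ ≤ 1 ∧ ∀ i ∈ s, γ ≤ f i := by
  classical
  rcases hs.toFinset.eq_empty_or_nonempty with he | hne
  · refine ⟨1, one_pos, le_rfl, fun i hi => ?_⟩
    have : i ∈ hs.toFinset := hs.mem_toFinset.mpr hi
    rw [he] at this
    simp at this
  · obtain ⟨i₀, hi₀, hmin⟩ := hs.toFinset.exists_min_image f hne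
    have h0 : 0 < f i₀ := h i₀ (hs.mem_toFinset.mp hi₀)
    exact ⟨min 1 (f i₀), lt_min one_pos h0, min_le_left _ _,
      fun i hi => (min_le_right _ _).trans (hmin i (hs.mem_toFinset.mpr hi))⟩

/-- `‖q‖ ≤ ‖y‖ + dist y q`. [folklore] -/
theorem norm_le_norm_add_dist' (y q : EuclideanSpace ℝ (Fin 3)) : ‖q‖ ≤ ‖y‖ + dist y q := by
  calc ‖q‖ = ‖y - (y - q)‖ := by rw [sub_sub_cancel]
    _ ≤ ‖y‖ + ‖y - q‖ := norm_sub_le _ _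
    _ = ‖y‖ + dist y q := by rw [dist_eq_norm]

/-! ## The margin event -/

/-- **The MARGIN EVENT** of the matched-root decomposition: `ν`-matching at the root by an admissible flexible-gap layered Barlow
template `π ∈ piSet` with the radii replaced by rational margins — `4b ≤ r₁' < r₁`, `5b ≤ r₂' < r₂`; every atom of the OPEN ball
`‖y‖ < r₁` is `ν`-close to the template; every template point with index in the finite set `I` is `ν`-close to an atom; every template
point with index outside `I` has norm `≥ r₂`. [decomposition vocabulary · ChartedPlanarOrder RigidityDoor · N stmt-AtomisticToContinuum-26636 · definition, not a cited fact] -/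
def MarginEvent (ν : ℝ) (r₁' r₁ r₂' r₂ : ℚ) (I : Finset (ℤ × ℤ × ℤ)) (S : Set E3) : Prop :=
  ∃ π ∈ piSet, 4 * π.1 ≤ (r₁' : ℝ) ∧ (r₁' : ℝ) < r₁ ∧ 5 * π.1 ≤ (r₂' : ℝ) ∧ (r₂' : ℝ) < r₂ ∧
    (∀ y ∈ S, ‖y‖ < (r₁ : ℝ) → ∃ k : ℤ × ℤ × ℤ, dist y (pt π k) ≤ ν) ∧
    (∀ k ∈ I, ∃ y ∈ S, dist y (pt π k) ≤ ν) ∧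
    (∀ k : ℤ × ℤ × ℤ, k ∉ I → (r₂ : ℝ) ≤ ‖pt π k‖)

/-! ## STUB 1: the matched-root event is the countable union of margin events -/

/-- **STUB 1.** On a rooted `δ`-hard-core configuration the matched-root event is the union over rational margins and finite index sets of
the margin events. [this work] -/
theorem matchedAt_iff_exists_marginEvent {δ : ℝ} (hδ : 0 < δ) (ν : ℝ)
    (S : LocalConfig.RootedHardCoreConfig E3 δ) :
    matchedAt ν (S.1 : LocalConfig E3).toMeasure 0 ↔
      ∃ (r₁' r₁ r₂' r₂ : ℚ) (I : Finset (ℤ × ℤ × ℤ)),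
        MarginEvent ν r₁' r₁ r₂' r₂ I ((S.1 : LocalConfig E3) : Set E3) := by
  classical
  have hsep := S.2.2
  set T : Set E3 := ((S.1 : LocalConfig E3) : Set E3) with hT
  have hsing : ∀ y : E3, (S.1 : LocalConfig E3).toMeasure {y} ≠ 0 ↔ y ∈ T := fun y => by
    rw [LocalConfig.toMeasure_def]; exact count_restrict_singleton_ne_zero_iff _ y
  constructor
  · rintro ⟨b, hb, hb1, A, s, z, hs, hgap, hz0, h1, h2⟩
    set π₀ : Param := (b, (A.toContinuousLinearMap, (s, z))) with hπ₀def
    have hπ₀ : π₀ ∈ piSet := ⟨hb, hb1, fun v => A.norm_map v, hs, hgap, hz0⟩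
    have hpt : ∀ k : ℤ × ℤ × ℤ, pt π₀ k = A (patVec b (haggLabel s k.1) (z k.1) k.2.1 k.2.2) := fun k => rfl
    -- norm gap above `4b` for the atoms
    have hfinA : {y : E3 | y ∈ T ∧ ‖y‖ ≤ 4 * b + 1}.Finite := by
      have hF : (closedBall (0 : E3) (4 * b + 1) ∩ T).Finite :=
        LocalConfig.finite_inter_of_separated hδ hsep (isCompact_closedBall 0 _)
      exact hF.subset fun y hy => ⟨mem_closedBall_zero_iff.mpr hy.2, hy.1⟩
    obtain ⟨ε₁, hε₁, hgap₁⟩ := exists_gap_on T (fun y : E3 => ‖y‖) (4 * b) hfinA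
    -- norm gap above `5b` for the template
    have hfinT : {k : ℤ × ℤ × ℤ | k ∈ (Set.univ : Set (ℤ × ℤ × ℤ)) ∧ ‖pt π₀ k‖ ≤ 5 * b + 1}.Finite :=
      (finite_index_norm_le hπ₀ (5 * b + 1)).subset fun k hk => hk.2
    obtain ⟨ε₂, hε₂, hgap₂⟩ := exists_gap_on Set.univ (fun k => ‖pt π₀ k‖) (5 * b) hfinT
    obtain ⟨B, hB⟩ := exists_index_finset (5 * b)
    obtain ⟨r₁, h4r₁, hr₁ε⟩ := exists_rat_btwn (show 4 * b < 4 * b + ε₁ by linarith)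
    obtain ⟨r₁', h4r₁', hr₁'⟩ := exists_rat_btwn h4r₁
    obtain ⟨r₂, h5r₂, hr₂ε⟩ := exists_rat_btwn (show 5 * b < 5 * b + ε₂ by linarith)
    obtain ⟨r₂', h5r₂', hr₂'⟩ := exists_rat_btwn h5r₂
    refine ⟨r₁', r₁, r₂', r₂, B.filter (fun k => ‖pt π₀ k‖ ≤ 5 * b), π₀, hπ₀, h4r₁'.le, hr₁', h5r₂'.le, hr₂',
      ?_, ?_, ?_⟩
    · intro y hy hyr
      have hy4 : ‖y‖ ≤ 4 * b := hgap₁ y hy (hyr.trans hr₁ε)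
      obtain ⟨y', hy', hd⟩ := h1 y (by rwa [dist_zero_right]) ((hsing y).mpr hy)
      rw [sub_zero] at hy'
      obtain ⟨m, i, j, rfl⟩ := hy'
      exact ⟨(m, i, j), by rw [hpt]; exact hd⟩
    · intro k hk
      rw [Finset.mem_filter] at hk
      obtain ⟨y, hy, hd⟩ := h2 (pt π₀ k) (by rw [sub_zero, hpt]; exact ⟨k.1, k.2.1, k.2.2, rfl⟩)
        (by rw [dist_zero_right]; exact hk.2)
      exact ⟨y, (hsing y).mp hy, hd⟩
    · intro k hk
      by_contra hlt
      push Not at hlt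
      have h5 : ‖pt π₀ k‖ ≤ 5 * b := hgap₂ k (Set.mem_univ _) (hlt.trans hr₂ε)
      exact hk (Finset.mem_filter.mpr ⟨hB π₀ hπ₀ k h5, h5⟩)
  · rintro ⟨r₁', r₁, r₂', r₂, I, π, hπ, h4, h4', h5, h5', hC1, hC2, hC3⟩
    obtain ⟨hb, hb1, hA, hs, hgap, hz0⟩ := hπ
    let A' : E3 →ₗᵢ[ℝ] E3 := ⟨π.2.1.toLinearMap, hA⟩
    have hpt : ∀ k : ℤ × ℤ × ℤ,
        pt π k = A' (patVec π.1 (haggLabel π.2.2.1 k.1) (π.2.2.2 k.1) k.2.1 k.2.2) := fun k => rfl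
    refine ⟨π.1, hb, hb1, A', π.2.2.1, π.2.2.2, hs, hgap, hz0, ?_, ?_⟩
    · intro y hyd hyμ
      have hy : y ∈ T := (hsing y).mp hyμ
      have hyr : ‖y‖ < r₁ := by rw [dist_zero_right] at hyd; linarith
      obtain ⟨k, hk⟩ := hC1 y hy hyr
      refine ⟨pt π k, ?_, hk⟩
      rw [sub_zero, hpt]
      exact ⟨k.1, k.2.1, k.2.2, rfl⟩
    · intro y' hy' hd'
      rw [sub_zero] at hy'
      obtain ⟨m, i, j, rfl⟩ := hy'
      have hd5 : dist (pt π (m, i, j)) 0 ≤ 5 * π.1 := hd'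
      by_cases hkI : (m, i, j) ∈ I
      · obtain ⟨y, hy, hd⟩ := hC2 _ hkI
        refine ⟨y, (hsing y).mpr hy, ?_⟩
        have hd'' : dist y (pt π (m, i, j)) ≤ ν := hd
        exact hd''
      · have := hC3 _ hkI
        rw [dist_zero_right] at hd5
        linarith

/-! ## STUB 2: margin events are closed in the local rubber topology -/

/-- **STUB 2.** Each margin event is closed in the local (rubber) topology of rooted `δ`-hard-core configurations. [this work] -/
theorem isClosed_marginEvent {δ : ℝ} (hδ : 0 < δ) (ν : ℝ) (r₁' r₁ r₂' r₂ : ℚ) (I : Finset (ℤ × ℤ × ℤ)) :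
    IsClosed {S : LocalConfig.RootedHardCoreConfig E3 δ |
      MarginEvent ν r₁' r₁ r₂' r₂ I ((S.1 : LocalConfig E3) : Set E3)} := by
  classical
  -- the constrained parameter set is compact
  set K : Set Param := piSet ∩ {π | 4 * π.1 ≤ (r₁' : ℝ) ∧ 5 * π.1 ≤ (r₂' : ℝ) ∧
      ∀ k : ℤ × ℤ × ℤ, k ∉ I → (r₂ : ℝ) ≤ ‖pt π k‖} with hKdef
  have hKc : IsClosed K := by
    rw [hKdef]
    refine isClosed_piSet.inter ?_
    rw [Set.setOf_and, Set.setOf_and]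
    refine (isClosed_le (continuous_const.mul continuous_fst) continuous_const).inter
      ((isClosed_le (continuous_const.mul continuous_fst) continuous_const).inter ?_)
    rw [Set.setOf_forall]
    refine isClosed_iInter fun k => ?_
    by_cases hk : k ∈ I
    · have : {π : Param | k ∉ I → (r₂ : ℝ) ≤ ‖pt π k‖} = Set.univ := by
        ext π
        simp only [Set.mem_setOf_eq, Set.mem_univ, iff_true]
        exact fun h => absurd hk h
      rw [this]; exact isClosed_univ
    · have : {π : Param | k ∉ I → (r₂ : ℝ) ≤ ‖pt π k‖} = {π : Param | (r₂ : ℝ) ≤ ‖pt π k‖} := by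
        ext π
        simp only [Set.mem_setOf_eq]
        exact ⟨fun h => h hk, fun h _ => h⟩
      rw [this]; exact isClosed_le continuous_const (continuous_pt k).norm
  have hK : IsCompact K := isCompact_piSet.of_isClosed_subset hKc Set.inter_subset_left
  by_cases hr : (r₁' : ℝ) < r₁ ∧ (r₂' : ℝ) < r₂
  swap
  · -- the event is empty
    have : {S : LocalConfig.RootedHardCoreConfig E3 δ |
        MarginEvent ν r₁' r₁ r₂' r₂ I ((S.1 : LocalConfig E3) : Set E3)} = ∅ := by
      ext S
      simp only [Set.mem_setOf_eq, Set.mem_empty_iff_false, iff_false]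
      rintro ⟨π, -, -, h1, -, h2, -⟩
      exact hr ⟨h1, h2⟩
    rw [this]; exact isClosed_empty
  obtain ⟨hr₁, hr₂⟩ := hr
  refine IsSeqClosed.isClosed ?_
  intro u S hu hlim
  -- witnessing parameters and a convergent subsequence of them
  have hu' : ∀ n, ∃ π ∈ K,
      (∀ y ∈ (((u n).1 : LocalConfig E3) : Set E3), ‖y‖ < (r₁ : ℝ) → ∃ k : ℤ × ℤ × ℤ, dist y (pt π k) ≤ ν) ∧
      (∀ k ∈ I, ∃ y ∈ (((u n).1 : LocalConfig E3) : Set E3), dist y (pt π k) ≤ ν) := by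
    intro n
    obtain ⟨π, hπ, h4, -, h5, -, hC1, hC2, hC3⟩ := hu n
    exact ⟨π, ⟨hπ, h4, h5, hC3⟩, hC1, hC2⟩
  choose π hπK hC1 hC2 using hu'
  obtain ⟨π₀, hπ₀K, φ, hφ, hπlim⟩ := hK.tendsto_subseq hπK
  obtain ⟨hπ₀, h4, h5, hC3⟩ := hπ₀K
  have hlim' : Tendsto (fun n => ((u (φ n)).1 : LocalConfig E3)) atTop (𝓝 (S.1 : LocalConfig E3)) :=
    (continuous_subtype_val.tendsto S).comp (hlim.comp hφ.tendsto_atTop)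
  have hLM : ∀ R ε : ℝ, 0 < ε → ∀ᶠ n in atTop,
      LocallyMatches R ε ((S.1 : LocalConfig E3) : Set E3) (((u (φ n)).1 : LocalConfig E3) : Set E3) :=
    fun R ε hε => LocalConfig.tendsto_iff_locallyMatches.1 hlim' R ε hε
  have hptlim : ∀ k : ℤ × ℤ × ℤ, Tendsto (fun n => pt (π (φ n)) k) atTop (𝓝 (pt π₀ k)) := fun k =>
    ((continuous_pt k).tendsto π₀).comp hπlim
  have hsepS := S.2.2
  refine ⟨π₀, hπ₀, h4, hr₁, h5, hr₂, ?_, ?_, hC3⟩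
  · -- the atom clause at the limit (OPEN radius)
    intro y hy hyr
    by_contra hne
    push Not at hne
    obtain ⟨B, hB⟩ := exists_index_finset ((r₁ : ℝ) + ν)
    obtain ⟨γ, hγ, hγ1, hγB⟩ := exists_pos_le_of_finite B.finite_toSet (fun k => dist y (pt π₀ k) - ν)
      (fun k _ => by linarith [hne k])
    set ε : ℝ := min (γ / 3) (((r₁ : ℝ) - ‖y‖) / 2) with hεdef
    have hε : 0 < ε := lt_min (by linarith) (by linarith)
    have hεγ : ε ≤ γ / 3 := min_le_left _ _
    have hεr : ε ≤ ((r₁ : ℝ) - ‖y‖) / 2 := min_le_right _ _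
    have ev1 := hLM (r₁ : ℝ) ε hε
    have ev2 : ∀ᶠ n in atTop, ∀ k ∈ B, pt (π (φ n)) k ∈ ball (pt π₀ k) (γ / 3) :=
      (B.eventually_all).2 fun k _ => (hptlim k).eventually_mem (ball_mem_nhds _ (by linarith))
    obtain ⟨n, hn1, hn2⟩ := (ev1.and ev2).exists
    obtain ⟨q, hq, hdq⟩ := hn1.2 y hy hyr.le
    have hqr : ‖q‖ < r₁ := by
      have := norm_le_norm_add_dist' y q
      linarith
    obtain ⟨k, hk⟩ := hC1 (φ n) q hq hqr
    have hkB : k ∈ B := by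
      refine hB (π (φ n)) (hπK (φ n)).1 k ?_
      have := norm_le_norm_add_dist' q (pt (π (φ n)) k)
      linarith
    have h3 : dist (pt (π (φ n)) k) (pt π₀ k) < γ / 3 := mem_ball.mp (hn2 k hkB)
    have hγk : γ ≤ dist y (pt π₀ k) - ν := hγB k (Finset.mem_coe.mpr hkB)
    have h4' := dist_triangle4 y q (pt (π (φ n)) k) (pt π₀ k)
    linarith
  · -- the template clause at the limit (FIXED finite index set)
    intro k hk
    by_contra hne
    push Not at hne
    set R : ℝ := ‖pt π₀ k‖ + ν + 1 with hRdef
    have hF : (closedBall (0 : E3) (R + 1) ∩ ((S.1 : LocalConfig E3) : Set E3)).Finite :=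
      LocalConfig.finite_inter_of_separated hδ hsepS (isCompact_closedBall 0 _)
    obtain ⟨γ, hγ, hγ1, hγF⟩ := exists_pos_le_of_finite hF (fun y => dist y (pt π₀ k) - ν)
      (fun y hy => by linarith [hne y hy.2])
    have ev1 := hLM R (γ / 3) (by linarith)
    have ev2 : ∀ᶠ n in atTop, pt (π (φ n)) k ∈ ball (pt π₀ k) (γ / 3) :=
      (hptlim k).eventually_mem (ball_mem_nhds _ (by linarith))
    obtain ⟨n, hn1, hn2⟩ := (ev1.and ev2).exists
    have h3 : dist (pt (π (φ n)) k) (pt π₀ k) < γ / 3 := mem_ball.mp hn2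
    obtain ⟨yn, hyn, hdn⟩ := hC2 (φ n) k hk
    have hyn_norm : ‖yn‖ ≤ R := by
      have h1 := norm_le_norm_add_dist' (pt (π (φ n)) k) yn
      have h2 := norm_le_norm_add_dist' (pt π₀ k) (pt (π (φ n)) k)
      rw [dist_comm] at h1 h2
      linarith
    obtain ⟨p, hp, hdp⟩ := hn1.1 yn hyn hyn_norm
    have hpF : p ∈ closedBall (0 : E3) (R + 1) ∩ ((S.1 : LocalConfig E3) : Set E3) := by
      refine ⟨mem_closedBall_zero_iff.mpr ?_, hp⟩
      have := norm_le_norm_add_dist' yn p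
      rw [dist_comm] at this
      linarith
    have hγp : γ ≤ dist p (pt π₀ k) - ν := hγF p hpF
    have h4' := dist_triangle4 p yn (pt (π (φ n)) k) (pt π₀ k)
    linarith

/-! ## Composition: Borel measurability and `SparseNull` -/

/-- **The matched-root event is Borel on configuration space**, for every `δ > 0`. [this work] -/
theorem measurableSet_matchedAt_config (ν : ℝ) :
    ∀ δ : ℝ, 0 < δ → MeasurableSet {S : LocalConfig.RootedHardCoreConfig E3 δ |
      matchedAt ν (S.1 : LocalConfig E3).toMeasure 0} := by
  intro δ hδ
  have hset : {S : LocalConfig.RootedHardCoreConfig E3 δ | matchedAt ν (S.1 : LocalConfig E3).toMeasure 0} =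
      ⋃ r₁' : ℚ, ⋃ r₁ : ℚ, ⋃ r₂' : ℚ, ⋃ r₂ : ℚ, ⋃ I : Finset (ℤ × ℤ × ℤ),
        {S : LocalConfig.RootedHardCoreConfig E3 δ |
          MarginEvent ν r₁' r₁ r₂' r₂ I ((S.1 : LocalConfig E3) : Set E3)} := by
    ext S
    simp only [Set.mem_setOf_eq, Set.mem_iUnion]
    exact matchedAt_iff_exists_marginEvent hδ ν S
  rw [hset]
  exact MeasurableSet.iUnion fun r₁' => MeasurableSet.iUnion fun r₁ => MeasurableSet.iUnion fun r₂' =>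
    MeasurableSet.iUnion fun r₂ => MeasurableSet.iUnion fun I =>
      (isClosed_marginEvent hδ ν r₁' r₁ r₂' r₂ I).measurableSet

/-- **`SparseNull ν` holds for every tolerance `ν`** (lens-3's TRUE piece of the `RigidityDoor` node on N 26636): Borel matched-root
event (this file) → measurable version on counting measures (lens-3 p814353, Lusin–Souslin) → Mecke / mass transport (hand-1 g7 p812751). [this work] -/
theorem sparseNull_holds (ν : ℝ) : SparseNull ν :=
  ChartedPlanarOrderMatchedRootTransport.sparseNull_of_measurableSet_config ν (measurableSet_matchedAt_config ν)

end Summit.AtomisticToContinuum.Crystallization.Theorems.ChartedPlanarOrderMatchedRootBorel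

end
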